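import Summits.Ventures.Crystal3D.Theorems.StickyWulffConstantCoaxialWallLawPayerTwinCellTopNm
import Summits.Ventures.Crystal3D.Theorems.StickyWulffConstantCoaxialWallLawEndUniqueTwoPlate
import Summits.Ventures.Crystal3D.Theorems.StickyWulffConstantCoaxialWallLawEndRowDischarge
import HarnessLib

/-!
# The TWO-PLATE twin cell UNDER THE CENSUS ROW: both plates' in-plane words, one pooled deficiency budget

HONEST FRAMING. Venture `Summits/Ventures/Crystal3D` (cell `crystal3d-full`), helper `--supports` the crux
`CoaxialWallLaw` (stmt-Ventures-19481, `route-Ventures-StickyWulffConstant`), REGISTERED line `WallLedgerF` (planner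
cf-p1), open stub `stub_coaxialTwoSlabAdhesion`.  Rung credit only; F-C1 not moved.  STEP-2 of DECISION (xxxiii)
(19481-p2 g6): `wordNet_twin_payers_ge_twoPlate` (`…PayerTwinCellTwoPlate`) with the family-blind capacity
`card_endPairs_le_payers_closed` (`78·#PAY`) REPLACED by the census row: the pooled end pairs of the bottom plate
(`wordNet_twin_endPairs_multi_nm`) and of the top plate pulled back (`wordNet_twin_endPairs_top_nm`) are disjoint
(LEMMA X / X″, verbatim) and every pair is an END PAIR (`IsEndPair … v1`, `…EndRowDefs`) of the two plate systems
`S₁ = ⟨F false, rising in-plane roots⟩`, `S₂ = ⟨F true, falling in-plane roots⟩`; the local row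
`LocalEndRow v1 sF S₁ S₂` (HYPOTHESIS — the census fact) then bounds their number by `sF` times the window's pooled
deficiency through `card_endPairs_le_of_localRow` (`…EndRowDischarge`):

`2 · (√2 · Σ_{r ∈ RT} (F false r)₂ · πρ²) − 24·(12√2π + 36R₀ + 55440)·ρ ≤ sF · Σ_{z ∈ X, deg z ≤ 11, −R₀−2 ≤ z₂ ≤ h+R₀+2} (12 − deg z)`

(`wordNet_twin_payers_ge_twoPlate_row`; inputs `KissingGap δ`, `KissingClassification δ` and the row BY NAME).

WHAT THIS IS NOT: not the assembly into the stub's inequality (next file, constant `√6/sF`, i.e. `½` at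
`sF = 2√6`); not the census; F-C1 not moved.
-/

noncomputable section

namespace Summit.Ventures.Crystal3D.Theorems

open Summit.Ventures.Crystal3D Finset
open Literature.MathematicalPhysics.StatisticalMechanics (fccStacking)
open scoped InnerProductSpace

open scoped Classical in
/-- **The two-plate twin cell under the census row.**  See the module docstring. -/
theorem wordNet_twin_payers_ge_twoPlate_row {δ : ℝ} (hg : KissingGap δ) (hc : KissingClassification δ)
    (L : EuclideanSpace ℝ (Fin 3) ≃ₗᵢ[ℝ] EuclideanSpace ℝ (Fin 3))
    (F : Bool → (EuclideanSpace ℝ (Fin 3) ≃ₗᵢ[ℝ] EuclideanSpace ℝ (Fin 3)))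
    (hF : (F false = L ∧ F true = (ℝ ∙ EuclideanSpace.single (2 : Fin 3) (1 : ℝ)).reflection.trans L) ∨
      (F false = (ℝ ∙ EuclideanSpace.single (2 : Fin 3) (1 : ℝ)).reflection.trans L ∧ F true = L))
    {n : EuclideanSpace ℝ (Fin 3)}
    (hn : n = L (EuclideanSpace.single (2 : Fin 3) (1 : ℝ)) ∨ n = -L (EuclideanSpace.single (2 : Fin 3) (1 : ℝ)))
    {sF : ℝ} (hrow : LocalEndRow WordVersion.v1 sF ⟨F false, inPlaneRoots (F false) 1⟩ ⟨F true, inPlaneRoots (F true) (-1)⟩)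
    (s₁ s₂ : EuclideanSpace ℝ (Fin 3)) (X P₁ P₂ : Finset (EuclideanSpace ℝ (Fin 3))) (R₀ h ρ : ℝ)
    (hR₀ : 10 ≤ R₀) (hh : 0 ≤ h) (hρ : R₀ ≤ ρ)
    (hX : ∀ p ∈ X, ∀ q ∈ X, p ≠ q → 1 ≤ dist p q)
    (hcell : ∀ p ∈ X, -(2 * R₀) ≤ p 2 ∧ p 2 ≤ h + 2 * R₀ ∧ p 0 ^ 2 + p 1 ^ 2 ≤ ρ ^ 2)
    (hP₁X : P₁ ⊆ X) (hP₂X : P₂ ⊆ X)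
    (hP₁ : ∀ p, p ∈ P₁ ↔ (p ∈ (fun q => F false q + s₁) '' fccStacking 1 (Real.sqrt (2 / 3)) ∧
      -(2 * R₀) ≤ p 2 ∧ p 2 ≤ -R₀ ∧ p 0 ^ 2 + p 1 ^ 2 ≤ ρ ^ 2))
    (hP₂ : ∀ p, p ∈ P₂ ↔ (p ∈ (fun q => F true q + s₂) '' fccStacking 1 (Real.sqrt (2 / 3)) ∧
      h + R₀ ≤ p 2 ∧ p 2 ≤ h + 2 * R₀ ∧ p 0 ^ 2 + p 1 ^ 2 ≤ ρ ^ 2)) :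
    2 * (Real.sqrt 2 * (∑ r ∈ fccSlots.filter (fun r => ⟪F false r, n⟫_ℝ = 0 ∧ 0 < (F false r) 2), (F false r) 2) *
        Real.pi * ρ ^ 2) - 24 * (12 * Real.sqrt 2 * Real.pi + 36 * R₀ + 55440) * ρ ≤
      sF * ∑ z ∈ X.filter (fun z => (X.filter fun q => dist z q = 1).card ≤ 11 ∧
          -R₀ - 2 ≤ z 2 ∧ z 2 ≤ h + R₀ + 2), ((12 : ℝ) - ((X.filter fun q => dist z q = 1).card : ℝ)) := by
  obtain ⟨Fw, hF0, hFc, T₁, hflux₁, hTpair₁, hTpay₁, hTwit₁⟩ :=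
    wordNet_twin_endPairs_multi_nm hg hc L F hF hn s₁ s₂ X P₁ P₂ R₀ h ρ hR₀ hh hρ hX hcell hP₁X hP₂X hP₁ hP₂
  obtain ⟨Fw₂, hF0₂, hFc₂, T₂, hflux₂, hTpair₂, hTpay₂, hTwit₂, hTnat₂⟩ :=
    wordNet_twin_endPairs_top_nm hg hc L F hF hn s₁ s₂ X P₁ P₂ R₀ h ρ hR₀ hh hρ hX hcell hP₁X hP₂X hP₁ hP₂
  -- the two word systems coincide
  have hFw : Fw = Fw₂ := by
    funext κ
    induction κ with
    | nil => rw [hF0₂, hF0]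
    | cons μ κ ih => rw [hFc₂, hFc, ih]
  subst hFw
  -- in-plane roots are horizontal model slots
  have hax : ∀ w, ⟪F false w, n⟫_ℝ = 0 ↔ w 2 = 0 := by
    intro w
    have h0 : ⟪F false w, L (EuclideanSpace.single (2 : Fin 3) (1 : ℝ))⟫_ℝ = w 2 := by
      rcases hF with ⟨h0, -⟩ | ⟨h0, -⟩ <;> rw [h0]
      · exact inner_frame_axis L w
      · exact inner_twinFrame_axis L w
    rcases hn with h' | h'
    · rw [h', h0]
    · rw [h', inner_neg_right, h0, neg_eq_zero]
  have hr0 : 0 < Real.sqrt (2 / 3) := Real.sqrt_pos.2 (by norm_num)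
  -- (1) the two pair sets are disjoint (LEMMA X / X″, on the projected witnesses)
  have hdisj : Disjoint T₁ T₂ := by
    rw [Finset.disjoint_left]
    intro bq h₁ h₂
    obtain ⟨r₁, hr₁, κ₁, -, hlet₁, hch₁, hdeep₁, hpatN₁⟩ := hTwit₁ bq h₁
    have hpat₁ := endWitness_of_nm hpatN₁
    obtain ⟨r₂, hr₂, κ₂, hlet₂, hch₂, ⟨l₂, hκ₂⟩, hpat₂⟩ := hTwit₂ bq h₂
    obtain ⟨hr₁S, hr₁n, hr₁up⟩ := mem_filter.1 hr₁
    obtain ⟨hr₂S, hr₂n, hr₂up⟩ := mem_filter.1 hr₂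
    by_cases hrr : r₁ = r₂
    · subst hrr
      have hdeep₁' : ∀ (l : List (EuclideanSpace ℝ (Fin 3))) (μ : EuclideanSpace ℝ (Fin 3)), κ₁ = l ++ [μ] →
          ⟪r₁, μ⟫_ℝ ≠ 0 := by
        intro l μ hl h0; have := hdeep₁ l μ hl; rw [h0] at this; exact hr0.ne this
      have hν : ⟪r₁, EuclideanSpace.single (2 : Fin 3) (1 : ℝ)⟫_ℝ = 0 := by
        rw [← apply_two_eq_inner_e₃]; exact (hax r₁).1 hr₁n
      exact word_target_ne_of_root_deepest hX hFc hlet₁ hlet₂ hch₁ hch₂ hr₁S hdeep₁' hκ₂ hν rfl rfl hpat₁ hpat₂ rfl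
    · have hne' : r₁ ≠ -r₂ := by
        intro h'
        rw [h', map_neg, PiLp.neg_apply] at hr₁up
        linarith
      exact word_target_ne_of_roots_ne hX hFc hlet₁ hlet₂ hch₁ hch₂ hr₁S hr₂S hrr hne' rfl rfl hpat₁ hpat₂ rfl
  -- (2) every pair of the union is an END PAIR of the two plate systems
  set S₁ : PlateSystem := ⟨F false, inPlaneRoots (F false) 1⟩ with hS₁
  set S₂ : PlateSystem := ⟨F true, inPlaneRoots (F true) (-1)⟩ with hS₂
  have hFwS : ∀ κ, Fw κ = S₁.Fw κ := by
    intro κ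
    induction κ with
    | nil => rw [hF0]; rfl
    | cons μ κ ih => rw [hFc, ih]; rfl
  set T := T₁.disjUnion T₂ hdisj with hT
  have hEP : ∀ bq ∈ T, IsEndPair X WordVersion.v1 S₁ S₂ bq.1 bq.2 := by
    intro bq hbq
    rcases mem_disjUnion.1 hbq with h₁ | h₂
    · obtain ⟨hb, hq, -, -, -⟩ := hTpair₁ bq h₁
      obtain ⟨r, hr, κ, hWF, -, -, -, hpatN⟩ := hTwit₁ bq h₁
      obtain ⟨hrS, hrn, hrup⟩ := mem_filter.1 hr
      refine ⟨hq, hb, hTpay₁ bq h₁, Fw κ, Fw κ (((-1 : ℝ) ^ κ.length) • r), Or.inl ⟨r, ?_, κ, hWF, hFwS κ, by rw [hFwS]⟩,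
        isEndMove_of_nm hpatN⟩
      exact mem_filter.2 ⟨hrS, (hax r).1 hrn, by rw [one_mul]; exact hrup⟩
    · obtain ⟨hb, hq, -, -, -⟩ := hTpair₂ bq h₂
      obtain ⟨G, d, hadm, hem⟩ := hTnat₂ bq h₂
      exact ⟨hq, hb, hTpay₂ bq h₂, G, d, Or.inr hadm, hem⟩
  -- (3) the discharge of the local row
  set PAYW := X.filter (fun z => (X.filter fun q => dist z q = 1).card ≤ 11 ∧
    -R₀ - 2 ≤ z 2 ∧ z 2 ≤ h + R₀ + 2) with hPAYW
  have hTX : ∀ bq ∈ T, bq.1 ∈ X := by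
    intro bq hbq
    rcases mem_disjUnion.1 hbq with h' | h'
    · exact (hTpair₁ bq h').1
    · exact (hTpair₂ bq h').1
  have hwin : ∀ bq ∈ T, -R₀ - 1 ≤ bq.1 2 ∧ bq.1 2 ≤ h + R₀ + 1 := by
    intro bq hbq
    rcases mem_disjUnion.1 hbq with h' | h'
    · obtain ⟨-, -, -, h4, h5⟩ := hTpair₁ bq h'; exact ⟨h4, h5.le⟩
    · obtain ⟨-, -, -, h4, h5⟩ := hTpair₂ bq h'; exact ⟨h4, h5⟩
  have hpayT : ∀ bq ∈ T, (X.filter fun q => dist bq.1 q = 1).card ≤ 11 ∨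
      ∃ z₁ ∈ X, ∃ z₂ ∈ X, z₁ ≠ z₂ ∧ dist bq.1 z₁ = 1 ∧ dist bq.1 z₂ = 1 ∧
        (X.filter fun q => dist z₁ q = 1).card ≤ 11 ∧ (X.filter fun q => dist z₂ q = 1).card ≤ 11 := by
    intro bq hbq
    rcases mem_disjUnion.1 hbq with h' | h'
    · exact hTpay₁ bq h'
    · exact hTpay₂ bq h'
  have hclosed : ∀ bq ∈ T, ∀ z ∈ X, dist bq.1 z ≤ 1 → (X.filter fun q => dist z q = 1).card ≤ 11 → z ∈ PAYW := by
    intro bq hbq z hzX hdz hz11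
    obtain ⟨h4, h5⟩ := hwin bq hbq
    have h2 : (z 2 - bq.1 2) ^ 2 ≤ 1 := by
      have := sq_sub_apply_le_dist_sq z bq.1 2
      rw [dist_comm] at hdz; nlinarith [this, hdz, dist_nonneg (x := z) (y := bq.1)]
    have h2' : |z 2 - bq.1 2| ≤ 1 := by rw [← sq_le_one_iff_abs_le_one]; exact h2
    obtain ⟨ha, hb⟩ := abs_le.1 h2'
    exact mem_filter.2 ⟨hzX, hz11, by linarith, by linarith⟩
  have hpay : ∀ bq ∈ T, ∃ z ∈ X, dist bq.1 z ≤ 1 ∧ (X.filter fun q => dist z q = 1).card ≤ 11 := by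
    intro bq hbq
    rcases hpayT bq hbq with h11 | ⟨z₁, hz₁, -, -, -, hd₁, -, hc₁, -⟩
    · exact ⟨bq.1, hTX bq hbq, by rw [dist_self]; norm_num, h11⟩
    · exact ⟨z₁, hz₁, hd₁.le, hc₁⟩
  -- the row's multiplicities dominate the pair counts
  have hmult : ∀ b, ((T.filter fun bq => bq.1 = b).card : ℝ) ≤ (endMult X WordVersion.v1 S₁ S₂ b : ℝ) := by
    intro b
    have : (T.filter fun bq => bq.1 = b).card ≤ (X.filter fun q => IsEndPair X WordVersion.v1 S₁ S₂ b q).card := by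
      refine card_le_card_of_injOn (fun bq => bq.2) (fun bq hbq => ?_) ?_
      · obtain ⟨hbqT, hb1⟩ := mem_filter.1 hbq
        have hep := hEP bq hbqT
        rw [hb1] at hep
        exact mem_coe.2 (mem_filter.2 ⟨hep.1, hep⟩)
      · intro bq hbq bq' hbq' heq
        obtain ⟨-, hb⟩ := mem_filter.1 (mem_coe.1 hbq)
        obtain ⟨-, hb'⟩ := mem_filter.1 (mem_coe.1 hbq')
        exact Prod.ext (hb.trans hb'.symm) heq
    exact_mod_cast this
  have hDnn : ∀ b, 0 ≤ pooledDef X b := by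
    intro b
    refine sum_nonneg fun z hz => ?_
    have : ((X.filter fun q => dist z q = 1).card : ℝ) ≤ 11 := by exact_mod_cast (mem_filter.1 hz).2.2
    linarith
  have hrow' : ∀ z ∈ PAYW,
      ∑ b ∈ X.filter (fun b => dist z b ≤ 1 ∧ 0 < (T.filter fun bq => bq.1 = b).card),
        ((T.filter fun bq => bq.1 = b).card : ℝ) /
          (∑ z' ∈ X.filter (fun z' => dist b z' ≤ 1 ∧ (X.filter fun q => dist z' q = 1).card ≤ 11),
            ((12 : ℝ) - ((X.filter fun q => dist z' q = 1).card : ℝ))) ≤ sF := by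
    intro z hz
    obtain ⟨hzX, hz11, -, -⟩ := mem_filter.1 hz
    have key := hrow X hX z hzX hz11
    refine le_trans ?_ key
    calc ∑ b ∈ X.filter (fun b => dist z b ≤ 1 ∧ 0 < (T.filter fun bq => bq.1 = b).card),
          ((T.filter fun bq => bq.1 = b).card : ℝ) / pooledDef X b
        ≤ ∑ b ∈ X.filter (fun b => dist z b ≤ 1 ∧ 0 < (T.filter fun bq => bq.1 = b).card),
          (endMult X WordVersion.v1 S₁ S₂ b : ℝ) / pooledDef X b :=
          sum_le_sum fun b _ => div_le_div_of_nonneg_right (hmult b) (hDnn b)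
      _ ≤ ∑ b ∈ X.filter (fun b => dist z b ≤ 1 ∧ 0 < endMult X WordVersion.v1 S₁ S₂ b),
          (endMult X WordVersion.v1 S₁ S₂ b : ℝ) / pooledDef X b := by
          refine sum_le_sum_of_subset_of_nonneg (fun b hb => ?_) fun b _ _ =>
            div_nonneg (Nat.cast_nonneg _) (hDnn b)
          obtain ⟨hbX, hd, hpos⟩ := mem_filter.1 hb
          refine mem_filter.2 ⟨hbX, hd, ?_⟩
          have := hmult b
          have hpos' : (0 : ℝ) < (T.filter fun bq => bq.1 = b).card := by exact_mod_cast hpos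
          exact_mod_cast (show (0 : ℝ) < endMult X WordVersion.v1 S₁ S₂ b by linarith)
  have key := card_endPairs_le_of_localRow T PAYW hTX (fun z hz => ⟨(mem_filter.1 hz).1, (mem_filter.1 hz).2.1⟩)
    hclosed hpay hrow'
  rw [hT, card_disjUnion] at key
  have hcast : (T₁.card : ℝ) + (T₂.card : ℝ) ≤ sF * ∑ z ∈ PAYW, ((12 : ℝ) - ((X.filter fun q => dist z q = 1).card : ℝ)) := by
    have : (((T₁.card + T₂.card : ℕ) : ℝ)) = (T₁.card : ℝ) + (T₂.card : ℝ) := by push_cast; ring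
    rw [← this]; exact key
  linarith only [hflux₁, hflux₂, hcast]

end Summit.Ventures.Crystal3D.Theorems

end
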